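import Summits.HodgeConjecture.HodgeConjecture.Cruxes.BlochSeedDiscOne.PhaseTorusLawAllCoranks

/-!
# Phase-torus law: the corank threshold is `≤ 13` — an INTEGER bad torus measure with 14 positive phases
# (hsemireg-phasetorus-typer-1 g0, idle target of director-hodge R19.220 ∕ l.6059; sibling of `PhaseTorusLawAllCoranks.lean` §4)

Crux of record `…Theses.EightfoldBlochSeeds.BlochSeedDiscOne` (stmt-HodgeConjecture-18881).  Nothing here proves HC, HC_AV, HC_CM,
H2 or 18881; census-neutral (every two-term census row needs corank `4` exactly — director R19.220; this is method-row
mathematics about the finite harmonic-analysis law `PhaseTorusLawN γ` of `PhaseTorusLawAllCoranks.lean`).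

THE WITNESS (plan-lens-HodgeAV-embed g0, `ideators/plan-lens-HodgeAV-embed/mu6/witness14_N4_integer.txt` 37585677afe5c35f, found by exact
LP; re-verified exactly by plan-lens-HodgeAV-control g5 `ctl/check14.py` 2014459f00e4f04b (bus l.6065) and by idea-crit-hsem-3 g0 memo-10 (l.6127)):
`ω₁₄ = 32·ω` is the integer function on `(ℤ/4)⁴` supported on 30 phases — value `+1` on twelve and `+2` on two points of
`{Σ_f τ_f ≡ 0 (mod 4)}` (the positive set `A`, `|A| = 14`), value `−1` on sixteen points of `{Σ_f τ_f ≡ 2 (mod 4)}` — with ALL 79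
admissible moments `0` and top moment `ω̂₁₄(1,1,1,1) = 32`.  Hence **`not_phaseTorusLawN_fourteen : ¬ PhaseTorusLawN 14`**, and with
`phaseTorusLawN_mono` the law fails at every corank `γ ≥ 14` (`not_phaseTorusLawN_of_fourteen_le`), sharpening §4's `16` to `14`:
the kernel window for the threshold is now `9 ≤ γ* ≤ 14` (`8` holds: `phaseTorusLaw8_holds`).

KERNEL ROUTE («decide-friendly after the ℤ/4 count rewrite», control l.6065).  The witness is typed as a table `pt14 : Fin 30 → PT`,
`wt14 : Fin 30 → ℤ`; `omega14 τ = Σ_i [pt14 i = τ]·wt14 i`.  For every frequency `k` the moment is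
`Σ_i wt14 i · i^{s_i}` with `s_i = Σ_f k_f·(pt14 i)_f ∈ ℤ/4`, i.e. `(c₀ − c₂) + (c₁ − c₃)·I` with the integer residue counts
`c_j(k) = Σ_{i : s_i = j} wt14 i` (`moment_omega14`); the 79 vanishing conditions `c₀ = c₂ ∧ c₁ = c₃` and the top value `(32, 0)` are
then ONE `decide` each over `Fin 30`-sums (no sum over the 256-point torus is evaluated by the kernel).  Everything PROVED; no `sorry`,
no named fact, no instance, no notation; axioms standard.
-/

namespace Summit.HodgeConjecture.HodgeConjecture.Cruxes.BlochSeedDiscOne.PhaseTorus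

open Finset BigOperators

/-! ## §1 The witness table -/

/-- the 30 support phases of the corank-14 witness (rows of `witness14_N4_integer.txt` 37585677afe5c35f, in file order:
the 14 positive phases first, then the 16 negative ones). -/
def pt14 : Fin 30 → PT :=
  ![![0, 0, 1, 3],
    ![0, 1, 3, 0],
    ![0, 3, 0, 1],
    ![1, 0, 1, 2],
    ![1, 1, 0, 2],
    ![1, 2, 1, 0],
    ![1, 3, 2, 2],
    ![2, 0, 1, 1],
    ![2, 1, 2, 3],
    ![2, 3, 3, 0],
    ![3, 0, 3, 2],
    ![3, 2, 0, 3],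
    ![3, 2, 2, 1],
    ![3, 2, 3, 0],
    ![0, 0, 0, 2],
    ![0, 2, 0, 0],
    ![0, 2, 3, 1],
    ![0, 3, 1, 2],
    ![1, 0, 0, 1],
    ![1, 0, 2, 3],
    ![1, 1, 1, 3],
    ![1, 3, 1, 1],
    ![2, 0, 2, 2],
    ![2, 1, 1, 2],
    ![2, 2, 2, 0],
    ![2, 2, 3, 3],
    ![3, 1, 2, 0],
    ![3, 1, 3, 3],
    ![3, 3, 0, 0],
    ![3, 3, 3, 1]]

/-- the integer weights `32·ω` on the support phases (`+1 ×12`, `+2 ×2`, `−1 ×16`). -/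
def wt14 : Fin 30 → ℤ :=
  ![1, 1, 2, 1, 1, 1, 1, 1, 2, 1, 1, 1, 1, 1, -1, -1, -1, -1, -1, -1, -1, -1, -1, -1, -1, -1, -1, -1, -1, -1]

/-- the witness as an integer function on the phase torus (zero off the 30 support phases). -/
def omega14Z (τ : PT) : ℤ := ∑ i : Fin 30, if pt14 i = τ then wt14 i else 0

/-- the witness `ω₁₄ : (ℤ/4)⁴ → ℝ`. -/
noncomputable def omega14 (τ : PT) : ℝ := (omega14Z τ : ℝ)

/-- its positive set `A = {ω₁₄ > 0}`. -/
def pos14 : Finset PT := Finset.univ.filter fun τ => 0 < omega14Z τ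

/-- the residue count `c_j(k) = Σ_{i : Σ_f k_f (pt14 i)_f = j} wt14 i`. -/
def cnt14 (k : PT) (j : ZMod 4) : ℤ := ∑ i : Fin 30, if (∑ f, k f * pt14 i f) = j then wt14 i else 0

/-! ## §2 The count rewrite of the moments -/

/-- `i^s` on `ℤ/4` split by residue: `i^s = [s=0] − [s=2] + ([s=1] − [s=3])·I`. -/
theorem u4_eq_ite (s : ZMod 4) :
    u4 s = ((if s = 0 then (1 : ℤ) else 0) - (if s = 2 then (1 : ℤ) else 0) : ℤ) +
      ((if s = 1 then (1 : ℤ) else 0) - (if s = 3 then (1 : ℤ) else 0) : ℤ) * Complex.I := by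
  have h01 : (0 : ZMod 4) ≠ 1 := by decide
  have h02 : (0 : ZMod 4) ≠ 2 := by decide
  have h03 : (0 : ZMod 4) ≠ 3 := by decide
  have h12 : (1 : ZMod 4) ≠ 2 := by decide
  have h13 : (1 : ZMod 4) ≠ 3 := by decide
  have h23 : (2 : ZMod 4) ≠ 3 := by decide
  rcases cases_zmod4 s with rfl | rfl | rfl | rfl
  · rw [u4_zero]; simp [h01, h02, h03]
  · rw [u4_one]; simp [h01.symm, h12, h13]
  · rw [u4_two]; simp [h02.symm, h12.symm, h23]
  · rw [u4_three]; simp [h03.symm, h13.symm, h23.symm]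

/-- every torus sum against `ω₁₄` is a sum over its 30-row table. -/
theorem sum_omega14_mul (g : PT → ℂ) : ∑ τ : PT, (omega14 τ : ℂ) * g τ = ∑ i : Fin 30, (wt14 i : ℂ) * g (pt14 i) := by
  have e : ∀ τ : PT, (omega14 τ : ℂ) * g τ = ∑ i : Fin 30, if pt14 i = τ then (wt14 i : ℂ) * g τ else 0 := by
    intro τ
    unfold omega14 omega14Z
    push_cast
    rw [Finset.sum_mul]
    refine Finset.sum_congr rfl fun i _ => ?_
    split_ifs <;> simp
  rw [Finset.sum_congr rfl fun τ _ => e τ, Finset.sum_comm]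
  refine Finset.sum_congr rfl fun i _ => ?_
  rw [Finset.sum_ite_eq]
  simp

/-- the moments of `ω₁₄` are supported sums: `ω̂₁₄(k) = Σ_i wt14 i · i^{Σ_f k_f (pt14 i)_f}`. -/
theorem moment_omega14_support (k : PT) :
    moment omega14 k = ∑ i : Fin 30, (wt14 i : ℂ) * u4 (∑ f, k f * pt14 i f) := by
  unfold moment
  simp_rw [chi_eq_u4]
  exact sum_omega14_mul _

/-- **THE COUNT REWRITE**: `ω̂₁₄(k) = (c₀ − c₂) + (c₁ − c₃)·I` with the integer residue counts `cnt14 k j`. -/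
theorem moment_omega14 (k : PT) :
    moment omega14 k = ((cnt14 k 0 - cnt14 k 2 : ℤ) : ℂ) + ((cnt14 k 1 - cnt14 k 3 : ℤ) : ℂ) * Complex.I := by
  rw [moment_omega14_support]
  simp_rw [u4_eq_ite, mul_add, ← mul_assoc, Finset.sum_add_distrib, ← Finset.sum_mul]
  unfold cnt14
  push_cast
  simp_rw [mul_sub, mul_ite, mul_one, mul_zero, Finset.sum_sub_distrib]

/-! ## §3 The three decidable facts and the theorem -/

/-- the 79 admissible residue counts balance: `c₀ = c₂` and `c₁ = c₃` (ONE `decide` over `Fin 30`-sums, all 256 frequencies). -/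
theorem cnt14_clean : ∀ k : PT, ((∀ f, k f ≠ 2) ∧ k ≠ (fun _ => 1) ∧ k ≠ (fun _ => 3)) →
    cnt14 k 0 = cnt14 k 2 ∧ cnt14 k 1 = cnt14 k 3 := by
  decide +kernel

/-- the top counts: `c₀(1,1,1,1) = 16`, `c₂ = −16`, `c₁ = c₃ = 0` (so `ω̂₁₄(1,1,1,1) = 32`). -/
theorem cnt14_top : cnt14 (fun _ => 1) 0 = 16 ∧ cnt14 (fun _ => 1) 2 = -16 ∧
    cnt14 (fun _ => 1) 1 = 0 ∧ cnt14 (fun _ => 1) 3 = 0 := by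
  decide +kernel

/-- the positive set has exactly 14 phases. -/
theorem pos14_card : pos14.card = 14 := by
  decide +kernel

/-- the clean moments of `ω₁₄` vanish. -/
theorem moment_omega14_clean (k : PT) (hk : KAdm k) : moment omega14 k = 0 := by
  obtain ⟨h02, h13⟩ := cnt14_clean k ⟨hk.1, hk.2.1, hk.2.2⟩
  rw [moment_omega14, h02, h13, sub_self, sub_self]
  simp

/-- the top moment of `ω₁₄` is `32`. -/
theorem moment_omega14_top : moment omega14 (fun _ => 1) = 32 := by
  obtain ⟨h0, h2, h1, h3⟩ := cnt14_top
  rw [moment_omega14, h0, h2, h1, h3]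
  norm_num

/-- `ω₁₄ ≤ 0` off its positive set. -/
theorem omega14_nonpos (τ : PT) (hτ : τ ∉ pos14) : omega14 τ ≤ 0 := by
  have h : ¬ 0 < omega14Z τ := fun hp => hτ (Finset.mem_filter.mpr ⟨Finset.mem_univ _, hp⟩)
  unfold omega14
  exact_mod_cast not_lt.mp h

/-- **THE LAW FAILS AT CORANK 14**: `ω₁₄` is non-positive off 14 phases, all its clean moments vanish, and its top moment
is `32 ≠ 0` (integer witness of plan-lens-HodgeAV-embed g0, exact LP; ×2 control g5, idea-crit-hsem-3 g0). -/
theorem not_phaseTorusLawN_fourteen : ¬ PhaseTorusLawN 14 := by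
  intro H
  have h := H omega14 pos14 (by rw [pos14_card]) omega14_nonpos moment_omega14_clean
  rw [moment_omega14_top] at h
  norm_num at h

/-- … hence at every corank `γ ≥ 14` (sharpens `not_phaseTorusLawN_of_le`; kernel threshold window `9 ≤ γ* ≤ 14`). -/
theorem not_phaseTorusLawN_of_fourteen_le {γ : ℕ} (h : 14 ≤ γ) : ¬ PhaseTorusLawN γ :=
  fun H => not_phaseTorusLawN_fourteen (phaseTorusLawN_mono h H)

end Summit.HodgeConjecture.HodgeConjecture.Cruxes.BlochSeedDiscOne.PhaseTorus
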